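import Literature.IUT.LogVolume.Corollary22PartIII
import Literature.IUT.LogVolume.Corollary22PartIAll
import HarnessLib

/-!
# [IUTchIV] Corollary 2.2 — REDUCED TO PART (ii): `(∀ K_V, (ii)) ⟹ ∃ H_unif, Corollary 2.2`

Mochizuki, *Inter-universal Teichmüller theory IV*, RIMS manuscript (Apr. 2020) = PRIMS **57**
(2021), Cor. 2.2 (i)–(iii), pp. 41–43 [claim: Mochizuki2012, status: disputed — parts (i) and (iii)
are classical and PROVED in the tree; part (ii) is the application of Theorem 1.10, typed, not
asserted].

PROOF-ONLY assembly: with part (i) proved for every `K_V` satisfying the printed hypotheses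
(`Cor22.partI_holds`, `Corollary22PartIAll.lean`: abc-iut-S-d2 / S3 / S-d1) and part (iii) derived from
part (i) with a uniform threshold (`Cor22.exists_corollary22_of_partI_partII`,
`Corollary22PartIII.lean`: abc-iut-L5-d3), the typed predicate `Cor22.Corollary22 H_unif`
(`Corollary22Statement.lean`, abc-iut-S3) follows — for a suitable `H_unif` — from part (ii) ALONE at
any uniform constant `H_II`: `Cor22.exists_corollary22_of_partII`. This isolates exactly the disputed
input of the campaign-S chain below Theorem 1.10: everything in Cor. 2.2 except "(ii) for every `K_V`
with the printed hypotheses" is now kernel-proved. No new definitions; no named fact; nothing here takes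
a side on [IUTchIII] Cor. 3.12.
-/

noncomputable section

namespace Literature.IUT.LogVolume

namespace Cor22

open Literature.NumberTheory.DiophantineGeometry.GenEll

/-- **[IUTchIV] Cor. 2.2 from its part (ii) alone.** If part (ii) of Cor. 2.2 holds, with some uniform
constant `H_II`, for every compactly bounded `K_V ⊆ U_X(ℚ̄)` whose support contains `2` and which satisfies
(∗^{j-inv}), then `Cor22.Corollary22 H_unif` holds for some `H_unif > 0` — parts (i)
(`Cor22.partI_holds`) and (iii) (`Cor22.exists_corollary22_of_partI_partII`, threshold in `H_unif`) being
PROVED. [cite: Mochizuki2012, Cor 2.2 pp.41–43] -/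
theorem exists_corollary22_of_partII {HII : ℝ} (hII : ∀ D : CBData, Hypotheses D → PartII D HII) :
    ∃ Hunif : ℝ, Corollary22 Hunif :=
  exists_corollary22_of_partI_partII partI_holds hII

end Cor22

end Literature.IUT.LogVolume

end
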